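/-
Copyright (c) 2026. All rights reserved.
Released under Apache 2.0 license as described in the file LICENSE.
-/
import Literature.Geometry.Kaehler.ComplexTorusQuaternionXSixIdealClassesSpecialVectors
import Literature.Geometry.Kaehler.ComplexTorusQuaternionSpecialVectorsOptimalOrders
import Literature.NumberTheory.Automorphic.ClassNumberConductorStep
import HarnessLib

/-!
# Optimal orders of special vectors in `O₆`: the class `ψ(ŷ)` has optimal order `B_{f₁} = ℤ[σ_{f₁}]`
# (`f₁ = 1` if `m ≢ 3`, `f₁ = 2` if `m ≡ 3 (mod 4)`) iff `y` is PRIMITIVE; hence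
# `#{[J] through γ : O_L(J) ∩ ℚ(γ) = B_{f₁}} = P(m) = |L_prim(m)/O₆^×|`

Fourth file of the Eichler-count plan for the X₆ special cycles (after `…XSixMaximalOrderLattice`, `…XSixRamification`,
`…XSixIdealClassesSpecialVectors`: `#(ThroughClass O₆ γ) = |L(m)/O₆^×|` via `[y] ↦ ψ(ŷ)`). Eichler's formula counts the
classes `[J]` with a PRESCRIBED optimal order `O_L(J) ∩ ℚ(γ) = B`; the orders of `ℚ(γ) ≅ ℚ(√−m)` through `γ` are the
tree's `B_f = Brandt.ordOf γ 0 m f = ℤ[σ_f]`, `σ_f = (γ + k)/f`, `f ∈ ellipticConductors 0 m` (conductor index `f` over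
`ℤ[γ]`, discriminant `−4m/f²`; `QuadraticOrdersConductors`). This file identifies WHICH special vectors give which `B_f`
at the bottom of the chain:

* §1 `gammaHyp_of_pure`, `gammaHyp_pureVec` (`Brandt.GammaHyp ŷ 0 m`: `trd ŷ = 0`, `nrd ŷ = m`, `0 < 4m`),
  `two_mem_ellipticConductors_of_emod_four` (`m ≡ 3 (4) ⇒ 2` is a conductor), `odd_shift_of_emod_four` (then the
  shift `k` is odd), the shapes `σ₁ = k + γ`, `σ₂ = (k + γ)/2`.
* §2 **`optimalOrder_maxOrderLattice_pureVec_eq_ordOf_iff`**: for `y ∈ L(m)`,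
  `O₆ ∩ ℚ(ŷ) = B_{f₁}(ŷ) ⟺ y primitive`, `f₁ = 1` (`m ≢ 3 mod 4`: `O₆ ∩ ℚ(ŷ) = ℤ[ŷ]`, the series'
  `coe_add_smul_maxOrder_iff_of_norm_emod_four_ne`) resp. `f₁ = 2` (`m ≡ 3 mod 4`: `O₆ ∩ ℚ(ŷ) = ℤ[(1+ŷ)/2]`,
  `…_of_norm_emod_four_eq`); a non-primitive `y = c·y₀` has `ŷ₀ = ŷ/c ∈ O₆ ∩ ℚ(ŷ) ∖ B_{f₁}`.
* §3 transport under `ψ`: **`optimalOrder_inv_smul_maxOrderLattice_eq_ordOf_iff`** (`O_L(b⁻¹O₆) ∩ ℚ(γ) = B_f(γ) ⟺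
  O₆ ∩ ℚ(bγb⁻¹) = B_f(bγb⁻¹)`: conjugation by `b` is an automorphism of `B` carrying `ℚ(γ)`, `σ_f(γ)` to `ℚ(bγb⁻¹)`,
  `σ_f(bγb⁻¹)`), so `optimalOrder_psi_pureVec_eq_ordOf_iff`: the class `ψ(ŷ)` has optimal order `B_{f₁}(γ)` iff `y`
  is primitive.
* §4 **`card_throughClass_ordOf_eq_card_primitive_classes`**:
  `#{[J] ∈ ThroughClass O₆ γ : O_L(J) ∩ ℚ(γ) = B_{f₁}} = |L_prim(m)/O₆^×| = P(m)` — the left side is what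
  `Brandt.card_throughClass_optimalOrder_eq_of_isUnit` evaluates as `h(B_{f₁})·m₂·m₃`.

## Sources

* M.-F. Vignéras, *Arithmétique des algèbres de quaternions*, LNM 800 (1980), Ch. II §3 Définition («`B` est
  maximalement plongé dans `O` si `O ∩ L = B`»), Ch. III §5 Thm. 5.11 (proof (2)), Cor. 5.12–5.14 («`Σ_B m_G(B)` où
  `B` parcourt les ordres de `K(h)` contenant `h`»). [cite: VignerasLNM800, Ch. II §3 Définition; Ch. III §5 Thm. 5.11, Cor. 5.12–5.14]
* D. A. Cox, *Primes of the form x² + ny²*, 2nd ed. (2013), §7.A Lemma 7.2, (7.2)–(7.3) (the orders `[1, fw_K]`,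
  conductor, discriminant `f²d_K`). [cite: Cox2013, §7.A Lemma 7.2]
* S. Kudla, M. Rapoport, T. Yang, *Modular Forms and Special Cycles on Shimura Curves* (2006), §3.4 (3.4.6) and
  Remark 3.4.7 («the action of `ℤ[√−t]` extends to an action of the order `O_{n₀²d}`»). [cite: KudlaRapoportYang2006, §3.4 (3.4.6) and Remark 3.4.7]

## Scope (honest)

Theorems only — no definition, no named fact, no instance. Only the bottom conductor `f₁ ∈ {1, 2}` (primitive vectors)
is identified; the general dictionary content `c` ↔ conductor `f ∈ {c, 2c}` is not needed (the series reduces `Z(t)`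
to the primitive cycles, `…XSixSpecialCyclesPrimitiveClassNumbers`) and is not proved here.
-/

set_option maxSynthPendingDepth 3

open Quaternion Function
open scoped Pointwise
open Literature.NumberTheory.Automorphic Literature.NumberTheory.Automorphic.Brandt
open Literature.NumberTheory.Automorphic.HeckeTraceFormulaGL2Level (ellipticConductors)

namespace Literature.Geometry.Kaehler.ComplexTorus.QuaternionType

/-! ## §1 `GammaHyp` for special vectors; the bottom conductors `1`, `2` -/

section Gamma

/-- **A pure `γ ∈ B` of norm `m > 0` satisfies `Brandt.GammaHyp γ 0 m`** (`trd γ = 0`, `nrd γ = m`, `0² < 4m`,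
division algebra): `ℚ(γ) ≅ ℚ(√−m)` is an imaginary quadratic field. [cite: VignerasLNM800, Ch. III §5 (C)] [cite: KudlaRapoportYang2006, §3.4 (3.4.8) («`k_t = ℚ(√−t)`»)] -/
theorem gammaHyp_of_pure {γ : ℍ[ℚ,((-1 : ℤ) : ℚ),((3 : ℤ) : ℚ)]} (hγ0 : γ.re = 0) {m : ℕ} (hm : 0 < m) (hγm : (γ * star γ).re = m) :
    GammaHyp γ 0 m := by
  refine ⟨forall_isUnit_neg_one_three, ?_, ?_, ?_⟩
  · rw [reducedTrace_eq_two_mul_re, hγ0, mul_zero, Int.cast_zero]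
  · rw [reducedNorm_eq_re_mul_star, hγm]
  · push_cast; linarith

/-- `GammaHyp ŷ 0 m` for `y ∈ L(m)`, `m > 0`. [cite: KudlaRapoportYang2006, §3.4 (3.4.8)] -/
theorem gammaHyp_pureVec {m : ℕ} (hm : 0 < m) (y : {x : ℤ × ℤ × ℤ // x.1 ^ 2 - 3 * x.2.1 ^ 2 - 3 * x.2.2 ^ 2 = (m : ℤ)}) :
    GammaHyp (⟨0, y.1.1, y.1.2.1, y.1.2.2⟩ : ℍ[ℚ,((-1 : ℤ) : ℚ),((3 : ℤ) : ℚ)]) 0 m :=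
  gammaHyp_of_pure rfl hm (by
    rw [re_mul_star_eq_coords]
    have h' : ((y.1.1 : ℤ) : ℚ) ^ 2 - 3 * ((y.1.2.1 : ℤ) : ℚ) ^ 2 - 3 * ((y.1.2.2 : ℤ) : ℚ) ^ 2 = ((m : ℤ) : ℚ) := by
      exact_mod_cast y.2
    show (0 : ℚ) ^ 2 + (y.1.1 : ℚ) ^ 2 - 3 * (y.1.2.1 : ℚ) ^ 2 - 3 * (y.1.2.2 : ℚ) ^ 2 = (m : ℕ)
    push_cast at h' ⊢
    linear_combination h')

/-- `0² < 4m` for `m > 0` (the hypothesis of the conductor calculus at `t = 0`, `n = m`). [folklore] -/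
private theorem hlt₆₃ {m : ℕ} (hm : 0 < m) : (0 : ℤ) ^ 2 < 4 * (m : ℕ) := by push_cast; linarith

/-- **`m ≡ 3 (mod 4) ⇒ 2 ∈ ellipticConductors 0 m`** (`−4m/2² = −m ≡ 1 (mod 4)`: `ℤ[√−m] ⊂ ℤ[(1+√−m)/2]` has
conductor index `2`). [cite: Cox2013, §7.A Lemma 7.2 and (7.2)] -/
theorem two_mem_ellipticConductors_of_emod_four {m : ℕ} (hm : 0 < m) (h3 : (m : ℤ) % 4 = 3) :
    2 ∈ ellipticConductors 0 m := by
  rw [mem_ellipticConductors_iff (hlt₆₃ hm)]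
  refine ⟨by norm_num, ⟨-(m : ℤ), by ring⟩, Or.inr ?_⟩
  have e : ((0 : ℤ) ^ 2 - 4 * ((m : ℕ) : ℤ)) / ((2 : ℕ) : ℤ) ^ 2 = -(m : ℤ) := by
    have e4 : ((2 : ℕ) : ℤ) ^ 2 = 4 := by norm_num
    rw [e4, show (0 : ℤ) ^ 2 - 4 * ((m : ℕ) : ℤ) = 4 * (-(m : ℤ)) by push_cast; ring,
      Int.mul_ediv_cancel_left _ (by norm_num)]
  rw [e]
  omega

/-- **For `m ≡ 3 (mod 4)` the shift `k` of `(0, m)` is odd** (`4 ∣ k² + m`). [cite: Cox2013, §7.A Lemma 7.2] -/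
theorem odd_shift_of_emod_four {m : ℕ} (hm : 0 < m) (h3 : (m : ℤ) % 4 = 3) : Odd (shift 0 m) := by
  obtain ⟨-, h4⟩ := dvd_shift (hlt₆₃ hm) (two_mem_ellipticConductors_of_emod_four hm h3)
  have h4' : (4 : ℤ) ∣ shift 0 m ^ 2 + m := by
    have e : ((2 : ℕ) : ℤ) ^ 2 = 4 := by norm_num
    rw [e] at h4
    simpa using h4
  rcases Int.even_or_odd (shift 0 m) with ⟨r, hr⟩ | hodd
  · exfalso
    rw [hr, show (r + r) ^ 2 + (m : ℤ) = 4 * (r ^ 2) + (m : ℤ) by ring] at h4'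
    have hm4 : (4 : ℤ) ∣ (m : ℤ) := (Int.dvd_add_right (dvd_mul_right 4 _)).1 h4'
    omega
  · exact hodd

/-- `σ₁ = k + γ`. [cite: Cox2013, §7.A Lemma 7.2] -/
theorem σf_one (γ : ℍ[ℚ,((-1 : ℤ) : ℚ),((3 : ℤ) : ℚ)]) (m : ℕ) : σf γ 0 m 1 = algebraMap ℚ ℍ[ℚ,((-1 : ℤ) : ℚ),((3 : ℤ) : ℚ)] (shift 0 m : ℚ) + γ := by
  simp only [σf, Nat.cast_one, div_one, inv_one, one_smul]

/-- `σ₂ = k/2 + γ/2`. [cite: Cox2013, §7.A Lemma 7.2] -/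
theorem σf_two (γ : ℍ[ℚ,((-1 : ℤ) : ℚ),((3 : ℤ) : ℚ)]) (m : ℕ) : σf γ 0 m 2 = algebraMap ℚ ℍ[ℚ,((-1 : ℤ) : ℚ),((3 : ℤ) : ℚ)] ((shift 0 m : ℚ) / 2) + (2 : ℚ)⁻¹ • γ := by
  simp only [σf, Nat.cast_ofNat]

end Gamma

/-! ## §2 The optimal order of a special vector: `O₆ ∩ ℚ(ŷ) = B_{f₁}(ŷ) ⟺ y` primitive -/

section Optimal

/-- Membership in `optimalOrder O₆ x`: `z ∈ O₆ ∧ z ∈ ℚ[x]`. [cite: VignerasLNM800, Ch. II §3 Définition] -/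
theorem mem_optimalOrder_maxOrderLattice_iff (x z : ℍ[ℚ,((-1 : ℤ) : ℚ),((3 : ℤ) : ℚ)]) :
    z ∈ optimalOrder (Submodule.span ℤ (Set.range ![(⟨1/2, 1/2, 1/2, -1/2⟩ : ℍ[ℚ,((-1 : ℤ) : ℚ),((3 : ℤ) : ℚ)]), ⟨0, 1, 0, 0⟩, ⟨0, 0, 1, 0⟩, ⟨0, 0, 0, 1⟩])) x ↔ (z ∈ order (-1) 3 ∨ z - ⟨1/2, 1/2, 1/2, -1/2⟩ ∈ order (-1) 3) ∧ z ∈ Algebra.adjoin ℚ {x} := by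
  rw [mem_optimalOrder_iff, leftOrder_maxOrderLattice, mem_maxOrderLattice_iff]

/-- Primitivity in `Fin 3` form. [folklore] -/
private theorem prim_fin₆₃ {y : ℤ × ℤ × ℤ} (h : ∃ u : ℤ × ℤ × ℤ, u.1 * y.1 + u.2.1 * y.2.1 + u.2.2 * y.2.2 = 1) :
    ∃ w : Fin 3 → ℤ, ∑ k, w k * (![y.1, y.2.1, y.2.2] : Fin 3 → ℤ) k = 1 := by
  obtain ⟨u, hu⟩ := h
  exact ⟨![u.1, u.2.1, u.2.2], by simpa [Fin.sum_univ_three] using hu⟩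

/-- `algebraMap ℚ B r + s • ŷ` is the series' `↑r + s • ⟨0, p 0, p 1, p 2⟩` with `p = ![y₁, y₂, y₃]`. [folklore] -/
private theorem algebraMap_add_smul_eq₆₃ (r s : ℚ) (y : ℤ × ℤ × ℤ) :
    algebraMap ℚ ℍ[ℚ,((-1 : ℤ) : ℚ),((3 : ℤ) : ℚ)] r + s • (⟨0, y.1, y.2.1, y.2.2⟩ : ℍ[ℚ,((-1 : ℤ) : ℚ),((3 : ℤ) : ℚ)]) =
      (r : ℍ[ℚ,((-1 : ℤ) : ℚ),((3 : ℤ) : ℚ)]) + s • (⟨0, (![y.1, y.2.1, y.2.2] : Fin 3 → ℤ) 0, (![y.1, y.2.1, y.2.2] : Fin 3 → ℤ) 1,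
        (![y.1, y.2.1, y.2.2] : Fin 3 → ℤ) 2⟩ : ℍ[ℚ,((-1 : ℤ) : ℚ),((3 : ℤ) : ℚ)]) := rfl

/-- The norm of `y` in `Fin 3` form. [folklore] -/
private theorem norm_fin₆₃ (y : ℤ × ℤ × ℤ) :
    (![y.1, y.2.1, y.2.2] : Fin 3 → ℤ) 0 ^ 2 - 3 * (![y.1, y.2.1, y.2.2] : Fin 3 → ℤ) 1 ^ 2 -
      3 * (![y.1, y.2.1, y.2.2] : Fin 3 → ℤ) 2 ^ 2 = (y.1 ^ 2 - 3 * y.2.1 ^ 2 - 3 * y.2.2 ^ 2) := rfl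

/-- **`m ≢ 3 (mod 4)`, `y ∈ L(m)` primitive ⇒ `O₆ ∩ ℚ(ŷ) = B₁(ŷ) = ℤ[ŷ]`** (the optimally embedded order is `ℤ[√−m]`,
discriminant `−4m`). [cite: VignerasLNM800, Ch. II §3 Définition] [cite: KudlaRapoportYang2006, §3.4 Remark 3.4.7] [cite: Cox2013, §7.A Lemma 7.2] -/
theorem optimalOrder_maxOrderLattice_pureVec_eq_ordOf_one {m : ℕ} (hm : 0 < m) (h3 : (m : ℤ) % 4 ≠ 3)
    (y : {x : ℤ × ℤ × ℤ // x.1 ^ 2 - 3 * x.2.1 ^ 2 - 3 * x.2.2 ^ 2 = (m : ℤ)}) (hprim : ∃ u : ℤ × ℤ × ℤ, u.1 * y.1.1 + u.2.1 * y.1.2.1 + u.2.2 * y.1.2.2 = 1) :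
    optimalOrder (Submodule.span ℤ (Set.range ![(⟨1/2, 1/2, 1/2, -1/2⟩ : ℍ[ℚ,((-1 : ℤ) : ℚ),((3 : ℤ) : ℚ)]), ⟨0, 1, 0, 0⟩, ⟨0, 0, 1, 0⟩, ⟨0, 0, 0, 1⟩])) (⟨0, y.1.1, y.1.2.1, y.1.2.2⟩ : ℍ[ℚ,((-1 : ℤ) : ℚ),((3 : ℤ) : ℚ)]) = ordOf (⟨0, y.1.1, y.1.2.1, y.1.2.2⟩ : ℍ[ℚ,((-1 : ℤ) : ℚ),((3 : ℤ) : ℚ)]) 0 m 1 := by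
  haveI := isQuaternionAlgebra_neg_one_three
  have hx : (⟨0, y.1.1, y.1.2.1, y.1.2.2⟩ : ℍ[ℚ,((-1 : ℤ) : ℚ),((3 : ℤ) : ℚ)]) ∉ (⊥ : Subalgebra ℚ ℍ[ℚ,((-1 : ℤ) : ℚ),((3 : ℤ) : ℚ)]) :=
    pureVec_not_mem_bot_of_norm_ne_zero y.2 (by exact_mod_cast hm.ne')
  have h3' : ((![y.1.1, y.1.2.1, y.1.2.2] : Fin 3 → ℤ) 0 ^ 2 - 3 * (![y.1.1, y.1.2.1, y.1.2.2] : Fin 3 → ℤ) 1 ^ 2 -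
      3 * (![y.1.1, y.1.2.1, y.1.2.2] : Fin 3 → ℤ) 2 ^ 2) % 4 ≠ 3 := by
    rw [norm_fin₆₃, y.2]; exact h3
  ext z
  rw [mem_optimalOrder_maxOrderLattice_iff, mem_ordOf_iff, σf_one]
  constructor
  · rintro ⟨hz, hadj⟩
    obtain ⟨r, s, rfl⟩ := exists_rat_eq_of_mem_adjoin forall_isUnit_neg_one_three hx hadj
    rw [algebraMap_add_smul_eq₆₃] at hz
    obtain ⟨⟨a, rfl⟩, ⟨b, rfl⟩⟩ := (coe_add_smul_maxOrder_iff_of_norm_emod_four_ne (prim_fin₆₃ hprim) h3' _ _).1 hz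
    refine ⟨a - b * shift 0 m, b, ?_⟩
    rw [← Int.cast_smul_eq_zsmul ℚ b, Int.cast_sub, Int.cast_mul]
    simp only [Algebra.algebraMap_eq_smul_one]
    module
  · rintro ⟨u, v, rfl⟩
    refine ⟨?_, ?_⟩
    · have e : algebraMap ℚ ℍ[ℚ,((-1 : ℤ) : ℚ),((3 : ℤ) : ℚ)] (u : ℚ) + v • (algebraMap ℚ ℍ[ℚ,((-1 : ℤ) : ℚ),((3 : ℤ) : ℚ)] (shift 0 m : ℚ) + ⟨0, y.1.1, y.1.2.1, y.1.2.2⟩) =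
          algebraMap ℚ ℍ[ℚ,((-1 : ℤ) : ℚ),((3 : ℤ) : ℚ)] (((u + v * shift 0 m : ℤ)) : ℚ) + ((v : ℤ) : ℚ) • (⟨0, y.1.1, y.1.2.1, y.1.2.2⟩ : ℍ[ℚ,((-1 : ℤ) : ℚ),((3 : ℤ) : ℚ)]) := by
        rw [← Int.cast_smul_eq_zsmul ℚ v, Int.cast_add, Int.cast_mul]
        simp only [Algebra.algebraMap_eq_smul_one]
        module
      rw [e, algebraMap_add_smul_eq₆₃]
      exact (coe_add_smul_maxOrder_iff_of_norm_emod_four_ne (prim_fin₆₃ hprim) h3' _ _).2 ⟨⟨_, rfl⟩, ⟨_, rfl⟩⟩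
    · exact Subalgebra.add_mem _ (Subalgebra.algebraMap_mem _ _)
        (zsmul_mem (Subalgebra.add_mem _ (Subalgebra.algebraMap_mem _ _) (Algebra.self_mem_adjoin_singleton ℚ _)) _)

/-- **`m ≡ 3 (mod 4)`, `y ∈ L(m)` primitive ⇒ `O₆ ∩ ℚ(ŷ) = B₂(ŷ) = ℤ[(1+ŷ)/2]`** (`σ₂ = (k + ŷ)/2`, `k` odd; the
optimally embedded order is `ℤ[(1+√−m)/2]`, discriminant `−m`). [cite: VignerasLNM800, Ch. II §3 Définition] [cite: KudlaRapoportYang2006, §3.4 Remark 3.4.7] [cite: Cox2013, §7.A Lemma 7.2] -/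
theorem optimalOrder_maxOrderLattice_pureVec_eq_ordOf_two {m : ℕ} (hm : 0 < m) (h3 : (m : ℤ) % 4 = 3)
    (y : {x : ℤ × ℤ × ℤ // x.1 ^ 2 - 3 * x.2.1 ^ 2 - 3 * x.2.2 ^ 2 = (m : ℤ)}) (hprim : ∃ u : ℤ × ℤ × ℤ, u.1 * y.1.1 + u.2.1 * y.1.2.1 + u.2.2 * y.1.2.2 = 1) :
    optimalOrder (Submodule.span ℤ (Set.range ![(⟨1/2, 1/2, 1/2, -1/2⟩ : ℍ[ℚ,((-1 : ℤ) : ℚ),((3 : ℤ) : ℚ)]), ⟨0, 1, 0, 0⟩, ⟨0, 0, 1, 0⟩, ⟨0, 0, 0, 1⟩])) (⟨0, y.1.1, y.1.2.1, y.1.2.2⟩ : ℍ[ℚ,((-1 : ℤ) : ℚ),((3 : ℤ) : ℚ)]) = ordOf (⟨0, y.1.1, y.1.2.1, y.1.2.2⟩ : ℍ[ℚ,((-1 : ℤ) : ℚ),((3 : ℤ) : ℚ)]) 0 m 2 := by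
  haveI := isQuaternionAlgebra_neg_one_three
  have hx : (⟨0, y.1.1, y.1.2.1, y.1.2.2⟩ : ℍ[ℚ,((-1 : ℤ) : ℚ),((3 : ℤ) : ℚ)]) ∉ (⊥ : Subalgebra ℚ ℍ[ℚ,((-1 : ℤ) : ℚ),((3 : ℤ) : ℚ)]) :=
    pureVec_not_mem_bot_of_norm_ne_zero y.2 (by exact_mod_cast hm.ne')
  have h3' : ((![y.1.1, y.1.2.1, y.1.2.2] : Fin 3 → ℤ) 0 ^ 2 - 3 * (![y.1.1, y.1.2.1, y.1.2.2] : Fin 3 → ℤ) 1 ^ 2 -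
      3 * (![y.1.1, y.1.2.1, y.1.2.2] : Fin 3 → ℤ) 2 ^ 2) % 4 = 3 := by
    rw [norm_fin₆₃, y.2]; exact h3
  obtain ⟨j, hj⟩ := odd_shift_of_emod_four hm h3
  have hjQ : (shift 0 m : ℚ) = 2 * j + 1 := by exact_mod_cast hj
  ext z
  rw [mem_optimalOrder_maxOrderLattice_iff, mem_ordOf_iff, σf_two]
  constructor
  · rintro ⟨hz, hadj⟩
    obtain ⟨r, s, rfl⟩ := exists_rat_eq_of_mem_adjoin forall_isUnit_neg_one_three hx hadj
    rw [algebraMap_add_smul_eq₆₃] at hz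
    obtain ⟨⟨N, hN⟩, ⟨M, hM⟩⟩ := (coe_add_smul_maxOrder_iff_of_norm_emod_four_eq (prim_fin₆₃ hprim) h3' _ _).1 hz
    have hs : s = (N : ℚ) / 2 := by linarith
    have hr : r = M + (N : ℚ) / 2 := by linarith
    refine ⟨M - N * j, N, ?_⟩
    rw [hr, hs, hjQ, ← Int.cast_smul_eq_zsmul ℚ N, Int.cast_sub, Int.cast_mul]
    simp only [Algebra.algebraMap_eq_smul_one]
    module
  · rintro ⟨u, v, rfl⟩
    refine ⟨?_, ?_⟩
    · have e : algebraMap ℚ ℍ[ℚ,((-1 : ℤ) : ℚ),((3 : ℤ) : ℚ)] (u : ℚ) + v • (algebraMap ℚ ℍ[ℚ,((-1 : ℤ) : ℚ),((3 : ℤ) : ℚ)] ((shift 0 m : ℚ) / 2) + (2 : ℚ)⁻¹ • ⟨0, y.1.1, y.1.2.1, y.1.2.2⟩) =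
          algebraMap ℚ ℍ[ℚ,((-1 : ℤ) : ℚ),((3 : ℤ) : ℚ)] ((u : ℚ) + v * (2 * j + 1) / 2) + ((v : ℚ) / 2) • (⟨0, y.1.1, y.1.2.1, y.1.2.2⟩ : ℍ[ℚ,((-1 : ℤ) : ℚ),((3 : ℤ) : ℚ)]) := by
        rw [hjQ, ← Int.cast_smul_eq_zsmul ℚ v]
        simp only [Algebra.algebraMap_eq_smul_one]
        module
      rw [e, algebraMap_add_smul_eq₆₃]
      exact (coe_add_smul_maxOrder_iff_of_norm_emod_four_eq (prim_fin₆₃ hprim) h3' _ _).2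
        ⟨⟨v, by ring⟩, ⟨u + v * j, by push_cast; ring⟩⟩
    · exact Subalgebra.add_mem _ (Subalgebra.algebraMap_mem _ _)
        (zsmul_mem (Subalgebra.add_mem _ (Subalgebra.algebraMap_mem _ _)
          (Subalgebra.smul_mem _ (Algebra.self_mem_adjoin_singleton ℚ _) _)) _)

/-- **A NON-primitive special vector does not have optimal order `B₁` or `B₂`**: for `y = c·y₀` with `c ≥ 2`, the
element `ŷ₀ = ŷ/c` lies in `O₆ ∩ ℚ(ŷ)` but its `ŷ`-coordinate `1/c` is not in `ℤ` (nor in `½ℤ` unless `c = 2`, which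
`m ≡ 3 (mod 4)` excludes). [cite: KudlaRapoportYang2006, §3.4 Remark 3.4.7 («`O_{n₀²d}`»)] [cite: Cox2013, §7.A Lemma 7.2] -/
theorem optimalOrder_maxOrderLattice_pureVec_ne_ordOf_of_not_primitive {m : ℕ} (hm : 0 < m) (y : {x : ℤ × ℤ × ℤ // x.1 ^ 2 - 3 * x.2.1 ^ 2 - 3 * x.2.2 ^ 2 = (m : ℤ)})
    (hnp : ¬ ∃ u : ℤ × ℤ × ℤ, u.1 * y.1.1 + u.2.1 * y.1.2.1 + u.2.2 * y.1.2.2 = 1) {f : ℕ}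
    (hf : f = 1 ∨ (f = 2 ∧ (m : ℤ) % 4 = 3)) :
    optimalOrder (Submodule.span ℤ (Set.range ![(⟨1/2, 1/2, 1/2, -1/2⟩ : ℍ[ℚ,((-1 : ℤ) : ℚ),((3 : ℤ) : ℚ)]), ⟨0, 1, 0, 0⟩, ⟨0, 0, 1, 0⟩, ⟨0, 0, 0, 1⟩])) (⟨0, y.1.1, y.1.2.1, y.1.2.2⟩ : ℍ[ℚ,((-1 : ℤ) : ℚ),((3 : ℤ) : ℚ)]) ≠ ordOf (⟨0, y.1.1, y.1.2.1, y.1.2.2⟩ : ℍ[ℚ,((-1 : ℤ) : ℚ),((3 : ℤ) : ℚ)]) 0 m f := by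
  haveI := isQuaternionAlgebra_neg_one_three
  intro heq
  have hx : (⟨0, y.1.1, y.1.2.1, y.1.2.2⟩ : ℍ[ℚ,((-1 : ℤ) : ℚ),((3 : ℤ) : ℚ)]) ∉ (⊥ : Subalgebra ℚ ℍ[ℚ,((-1 : ℤ) : ℚ),((3 : ℤ) : ℚ)]) :=
    pureVec_not_mem_bot_of_norm_ne_zero y.2 (by exact_mod_cast hm.ne')
  have hx0 : (⟨0, y.1.1, y.1.2.1, y.1.2.2⟩ : ℍ[ℚ,((-1 : ℤ) : ℚ),((3 : ℤ) : ℚ)]) ≠ 0 := fun h => hx (h ▸ Subalgebra.zero_mem _)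
  have hxo : (⟨0, y.1.1, y.1.2.1, y.1.2.2⟩ : ℍ[ℚ,((-1 : ℤ) : ℚ),((3 : ℤ) : ℚ)]) ∈ order (-1) 3 :=
    ⟨![0, y.1.1, y.1.2.1, y.1.2.2], by unfold ofCoords; rw [QuaternionAlgebra.mk.injEq]; simp⟩
  obtain ⟨g, p, hg, hp, hgp⟩ := special_eq_content_smul_primitive hxo rfl hx0
  -- the coordinates: `y = g·p`
  have hy1 : y.1.1 = g * p 0 := by
    have h := congrArg QuaternionAlgebra.imI hgp
    simp only [QuaternionAlgebra.smul_mk, smul_eq_mul, mul_zero] at h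
    exact_mod_cast h
  have hy2 : y.1.2.1 = g * p 1 := by
    have h := congrArg QuaternionAlgebra.imJ hgp
    simp only [QuaternionAlgebra.smul_mk, smul_eq_mul, mul_zero] at h
    exact_mod_cast h
  have hy3 : y.1.2.2 = g * p 2 := by
    have h := congrArg QuaternionAlgebra.imK hgp
    simp only [QuaternionAlgebra.smul_mk, smul_eq_mul, mul_zero] at h
    exact_mod_cast h
  -- `g ≠ 1` since `y` is not primitive
  have hg1 : g ≠ 1 := by
    rintro rfl
    obtain ⟨u, hu⟩ := hp
    apply hnp
    refine ⟨(u 0, u 1, u 2), ?_⟩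
    rw [hy1, hy2, hy3]
    simp only [Nat.cast_one, one_mul]
    simpa [Fin.sum_univ_three] using hu
  -- `p̂ ∈ O₆ ∩ ℚ(ŷ) = B_f`
  have hpmem : (⟨0, p 0, p 1, p 2⟩ : ℍ[ℚ,((-1 : ℤ) : ℚ),((3 : ℤ) : ℚ)]) ∈ optimalOrder (Submodule.span ℤ (Set.range ![(⟨1/2, 1/2, 1/2, -1/2⟩ : ℍ[ℚ,((-1 : ℤ) : ℚ),((3 : ℤ) : ℚ)]), ⟨0, 1, 0, 0⟩, ⟨0, 0, 1, 0⟩, ⟨0, 0, 0, 1⟩])) (⟨0, y.1.1, y.1.2.1, y.1.2.2⟩ : ℍ[ℚ,((-1 : ℤ) : ℚ),((3 : ℤ) : ℚ)]) := by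
    rw [mem_optimalOrder_maxOrderLattice_iff]
    refine ⟨Or.inl ⟨![0, p 0, p 1, p 2], by unfold ofCoords; rw [QuaternionAlgebra.mk.injEq]; simp⟩, ?_⟩
    have e : (⟨0, p 0, p 1, p 2⟩ : ℍ[ℚ,((-1 : ℤ) : ℚ),((3 : ℤ) : ℚ)]) = ((g : ℚ))⁻¹ • (⟨0, y.1.1, y.1.2.1, y.1.2.2⟩ : ℍ[ℚ,((-1 : ℤ) : ℚ),((3 : ℤ) : ℚ)]) := by
      rw [hgp, smul_smul, inv_mul_cancel₀ (by exact_mod_cast hg.ne'), one_smul]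
    rw [e]
    exact Subalgebra.smul_mem _ (Algebra.self_mem_adjoin_singleton ℚ _) _
  rw [heq, mem_ordOf_iff] at hpmem
  obtain ⟨u, v, huv⟩ := hpmem
  -- compare `ŷ`-coordinates: `1/g = v/f`
  have hcoord : algebraMap ℚ ℍ[ℚ,((-1 : ℤ) : ℚ),((3 : ℤ) : ℚ)] 0 + ((g : ℚ))⁻¹ • (⟨0, y.1.1, y.1.2.1, y.1.2.2⟩ : ℍ[ℚ,((-1 : ℤ) : ℚ),((3 : ℤ) : ℚ)]) =
      algebraMap ℚ ℍ[ℚ,((-1 : ℤ) : ℚ),((3 : ℤ) : ℚ)] ((u : ℚ) + v * (shift 0 m : ℚ) / f) + ((v : ℚ) / f) • (⟨0, y.1.1, y.1.2.1, y.1.2.2⟩ : ℍ[ℚ,((-1 : ℤ) : ℚ),((3 : ℤ) : ℚ)]) := by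
    have e1 : algebraMap ℚ ℍ[ℚ,((-1 : ℤ) : ℚ),((3 : ℤ) : ℚ)] 0 + ((g : ℚ))⁻¹ • (⟨0, y.1.1, y.1.2.1, y.1.2.2⟩ : ℍ[ℚ,((-1 : ℤ) : ℚ),((3 : ℤ) : ℚ)]) = (⟨0, p 0, p 1, p 2⟩ : ℍ[ℚ,((-1 : ℤ) : ℚ),((3 : ℤ) : ℚ)]) := by
      rw [map_zero, zero_add, hgp, smul_smul, inv_mul_cancel₀ (by exact_mod_cast hg.ne'), one_smul]
    rw [e1, huv, σf, ← Int.cast_smul_eq_zsmul ℚ v]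
    simp only [Algebra.algebraMap_eq_smul_one]
    module
  have hvf := (rat_coords_unique hx hcoord).2
  have hf0 : (f : ℚ) ≠ 0 := by rcases hf with rfl | ⟨rfl, -⟩ <;> norm_num
  have hfvg : (f : ℤ) = v * g := by
    have h : (f : ℚ) = v * g := by
      field_simp at hvf
      linarith
    exact_mod_cast h
  have hgdvd : (g : ℤ) ∣ f := ⟨v, by rw [hfvg]; ring⟩
  rcases hf with rfl | ⟨rfl, h3⟩
  · -- `g ∣ 1`
    have : (g : ℤ) = 1 := Int.eq_one_of_dvd_one (by positivity) hgdvd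
    exact hg1 (by exact_mod_cast this)
  · -- `g ∣ 2`, `g ≠ 1` ⇒ `g = 2` ⇒ `4 ∣ m`
    have hg2 : (g : ℤ) ≤ 2 := Int.le_of_dvd (by norm_num) hgdvd
    have hg2' : g = 2 := by omega
    have hQ := y.2
    rw [hy1, hy2, hy3, hg2'] at hQ
    push_cast at hQ
    have : (m : ℤ) = 4 * (p 0 ^ 2 - 3 * p 1 ^ 2 - 3 * p 2 ^ 2) := by linarith
    omega

/-- **`O₆ ∩ ℚ(ŷ) = B_{f₁}(ŷ) ⟺ y` PRIMITIVE**, `f₁ = 2` if `m ≡ 3 (mod 4)` and `f₁ = 1` otherwise: the bottom order of the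
chain `B_f ∋ ŷ` is optimally embedded exactly at the primitive vectors (`gcd(y₁, y₂, y₃) = 1`).
[cite: VignerasLNM800, Ch. II §3 Définition; Ch. III §5 Cor. 5.14] [cite: KudlaRapoportYang2006, §3.4 (3.4.6) and Remark 3.4.7] -/
theorem optimalOrder_maxOrderLattice_pureVec_eq_ordOf_iff {m : ℕ} (hm : 0 < m) (y : {x : ℤ × ℤ × ℤ // x.1 ^ 2 - 3 * x.2.1 ^ 2 - 3 * x.2.2 ^ 2 = (m : ℤ)}) :
    optimalOrder (Submodule.span ℤ (Set.range ![(⟨1/2, 1/2, 1/2, -1/2⟩ : ℍ[ℚ,((-1 : ℤ) : ℚ),((3 : ℤ) : ℚ)]), ⟨0, 1, 0, 0⟩, ⟨0, 0, 1, 0⟩, ⟨0, 0, 0, 1⟩])) (⟨0, y.1.1, y.1.2.1, y.1.2.2⟩ : ℍ[ℚ,((-1 : ℤ) : ℚ),((3 : ℤ) : ℚ)]) = ordOf (⟨0, y.1.1, y.1.2.1, y.1.2.2⟩ : ℍ[ℚ,((-1 : ℤ) : ℚ),((3 : ℤ) : ℚ)]) 0 m (if (m : ℤ) % 4 = 3 then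 2 else 1) ↔
      ∃ u : ℤ × ℤ × ℤ, u.1 * y.1.1 + u.2.1 * y.1.2.1 + u.2.2 * y.1.2.2 = 1 := by
  by_cases h3 : (m : ℤ) % 4 = 3
  · rw [if_pos h3]
    refine ⟨fun h => ?_, optimalOrder_maxOrderLattice_pureVec_eq_ordOf_two hm h3 y⟩
    by_contra hnp
    exact optimalOrder_maxOrderLattice_pureVec_ne_ordOf_of_not_primitive hm y hnp (Or.inr ⟨rfl, h3⟩) h
  · rw [if_neg h3]
    refine ⟨fun h => ?_, optimalOrder_maxOrderLattice_pureVec_eq_ordOf_one hm h3 y⟩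
    by_contra hnp
    exact optimalOrder_maxOrderLattice_pureVec_ne_ordOf_of_not_primitive hm y hnp (Or.inl rfl) h

end Optimal

/-! ## §3 Transport under conjugation: the optimal order of the class `ψ(ŷ)` -/

section Transport

/-- Conjugation fixes scalars and is `ℚ`-linear: `b(r + sγ)b⁻¹ = r + s·bγb⁻¹`. [folklore] -/
private theorem conj_algebraMap_add_smul₆₃ (b : (ℍ[ℚ,((-1 : ℤ) : ℚ),((3 : ℤ) : ℚ)])ˣ) (r s : ℚ) (γ : ℍ[ℚ,((-1 : ℤ) : ℚ),((3 : ℤ) : ℚ)]) :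
    (b : ℍ[ℚ,((-1 : ℤ) : ℚ),((3 : ℤ) : ℚ)]) * (algebraMap ℚ ℍ[ℚ,((-1 : ℤ) : ℚ),((3 : ℤ) : ℚ)] r + s • γ) * ((b⁻¹ : (ℍ[ℚ,((-1 : ℤ) : ℚ),((3 : ℤ) : ℚ)])ˣ) : ℍ[ℚ,((-1 : ℤ) : ℚ),((3 : ℤ) : ℚ)]) =
      algebraMap ℚ ℍ[ℚ,((-1 : ℤ) : ℚ),((3 : ℤ) : ℚ)] r + s • ((b : ℍ[ℚ,((-1 : ℤ) : ℚ),((3 : ℤ) : ℚ)]) * γ * ((b⁻¹ : (ℍ[ℚ,((-1 : ℤ) : ℚ),((3 : ℤ) : ℚ)])ˣ) : ℍ[ℚ,((-1 : ℤ) : ℚ),((3 : ℤ) : ℚ)])) := by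
  rw [mul_add, add_mul, ← Algebra.commutes r (b : ℍ[ℚ,((-1 : ℤ) : ℚ),((3 : ℤ) : ℚ)]), mul_assoc (algebraMap ℚ ℍ[ℚ,((-1 : ℤ) : ℚ),((3 : ℤ) : ℚ)] r), Units.mul_inv, mul_one,
    mul_smul_comm, smul_mul_assoc]

/-- `bγb⁻¹ ∉ ℚ` when `γ ∉ ℚ`. [folklore] -/
private theorem conj_not_mem_bot₆₃ {γ : ℍ[ℚ,((-1 : ℤ) : ℚ),((3 : ℤ) : ℚ)]} (hγ : γ ∉ (⊥ : Subalgebra ℚ ℍ[ℚ,((-1 : ℤ) : ℚ),((3 : ℤ) : ℚ)])) (b : (ℍ[ℚ,((-1 : ℤ) : ℚ),((3 : ℤ) : ℚ)])ˣ) :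
    (b : ℍ[ℚ,((-1 : ℤ) : ℚ),((3 : ℤ) : ℚ)]) * γ * ((b⁻¹ : (ℍ[ℚ,((-1 : ℤ) : ℚ),((3 : ℤ) : ℚ)])ˣ) : ℍ[ℚ,((-1 : ℤ) : ℚ),((3 : ℤ) : ℚ)]) ∉ (⊥ : Subalgebra ℚ ℍ[ℚ,((-1 : ℤ) : ℚ),((3 : ℤ) : ℚ)]) := by
  intro h
  obtain ⟨c, hc⟩ := Algebra.mem_bot.1 h
  apply hγ
  have : γ = algebraMap ℚ ℍ[ℚ,((-1 : ℤ) : ℚ),((3 : ℤ) : ℚ)] c := by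
    have e : γ = ((b⁻¹ : (ℍ[ℚ,((-1 : ℤ) : ℚ),((3 : ℤ) : ℚ)])ˣ) : ℍ[ℚ,((-1 : ℤ) : ℚ),((3 : ℤ) : ℚ)]) * ((b : ℍ[ℚ,((-1 : ℤ) : ℚ),((3 : ℤ) : ℚ)]) * γ * ((b⁻¹ : (ℍ[ℚ,((-1 : ℤ) : ℚ),((3 : ℤ) : ℚ)])ˣ) : ℍ[ℚ,((-1 : ℤ) : ℚ),((3 : ℤ) : ℚ)])) * b := by
      rw [← mul_assoc, ← mul_assoc, Units.inv_mul, one_mul, mul_assoc, Units.inv_mul, mul_one]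
    rw [e, ← hc, ← Algebra.commutes c, mul_assoc, Units.inv_mul, mul_one]
  rw [this]
  exact Subalgebra.algebraMap_mem _ c

/-- `z ∈ ℚ[γ] ⟺ bzb⁻¹ ∈ ℚ[bγb⁻¹]`. [cite: VignerasLNM800, Ch. I §2 (automorphismes intérieurs)] -/
theorem conj_mem_adjoin_iff [IsQuaternionAlgebra ℚ ℍ[ℚ,((-1 : ℤ) : ℚ),((3 : ℤ) : ℚ)]] {γ : ℍ[ℚ,((-1 : ℤ) : ℚ),((3 : ℤ) : ℚ)]} (hγ : γ ∉ (⊥ : Subalgebra ℚ ℍ[ℚ,((-1 : ℤ) : ℚ),((3 : ℤ) : ℚ)])) (b : (ℍ[ℚ,((-1 : ℤ) : ℚ),((3 : ℤ) : ℚ)])ˣ)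
    (z : ℍ[ℚ,((-1 : ℤ) : ℚ),((3 : ℤ) : ℚ)]) :
    (b : ℍ[ℚ,((-1 : ℤ) : ℚ),((3 : ℤ) : ℚ)]) * z * ((b⁻¹ : (ℍ[ℚ,((-1 : ℤ) : ℚ),((3 : ℤ) : ℚ)])ˣ) : ℍ[ℚ,((-1 : ℤ) : ℚ),((3 : ℤ) : ℚ)]) ∈ Algebra.adjoin ℚ {(b : ℍ[ℚ,((-1 : ℤ) : ℚ),((3 : ℤ) : ℚ)]) * γ * ((b⁻¹ : (ℍ[ℚ,((-1 : ℤ) : ℚ),((3 : ℤ) : ℚ)])ˣ) : ℍ[ℚ,((-1 : ℤ) : ℚ),((3 : ℤ) : ℚ)])} ↔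
      z ∈ Algebra.adjoin ℚ {γ} := by
  constructor
  · intro h
    obtain ⟨r, s, hrs⟩ := exists_rat_eq_of_mem_adjoin forall_isUnit_neg_one_three (conj_not_mem_bot₆₃ hγ b) h
    have hz : z = algebraMap ℚ ℍ[ℚ,((-1 : ℤ) : ℚ),((3 : ℤ) : ℚ)] r + s • γ := by
      have e : z = ((b⁻¹ : (ℍ[ℚ,((-1 : ℤ) : ℚ),((3 : ℤ) : ℚ)])ˣ) : ℍ[ℚ,((-1 : ℤ) : ℚ),((3 : ℤ) : ℚ)]) * ((b : ℍ[ℚ,((-1 : ℤ) : ℚ),((3 : ℤ) : ℚ)]) * z * ((b⁻¹ : (ℍ[ℚ,((-1 : ℤ) : ℚ),((3 : ℤ) : ℚ)])ˣ) : ℍ[ℚ,((-1 : ℤ) : ℚ),((3 : ℤ) : ℚ)])) * b := by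
        rw [← mul_assoc, ← mul_assoc, Units.inv_mul, one_mul, mul_assoc, Units.inv_mul, mul_one]
      rw [e, hrs, ← conj_algebraMap_add_smul₆₃ b r s γ, ← mul_assoc, ← mul_assoc, Units.inv_mul, one_mul, mul_assoc,
        Units.inv_mul, mul_one]
    rw [hz]
    exact Subalgebra.add_mem _ (Subalgebra.algebraMap_mem _ _) (Subalgebra.smul_mem _ (Algebra.self_mem_adjoin_singleton ℚ _) _)
  · intro h
    obtain ⟨r, s, rfl⟩ := exists_rat_eq_of_mem_adjoin forall_isUnit_neg_one_three hγ h
    rw [conj_algebraMap_add_smul₆₃]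
    exact Subalgebra.add_mem _ (Subalgebra.algebraMap_mem _ _) (Subalgebra.smul_mem _ (Algebra.self_mem_adjoin_singleton ℚ _) _)

/-- `σ_f(bγb⁻¹) = b σ_f(γ) b⁻¹`. [cite: Cox2013, §7.A Lemma 7.2] -/
theorem conj_σf (b : (ℍ[ℚ,((-1 : ℤ) : ℚ),((3 : ℤ) : ℚ)])ˣ) (γ : ℍ[ℚ,((-1 : ℤ) : ℚ),((3 : ℤ) : ℚ)]) (t : ℤ) (n f : ℕ) :
    (b : ℍ[ℚ,((-1 : ℤ) : ℚ),((3 : ℤ) : ℚ)]) * σf γ t n f * ((b⁻¹ : (ℍ[ℚ,((-1 : ℤ) : ℚ),((3 : ℤ) : ℚ)])ˣ) : ℍ[ℚ,((-1 : ℤ) : ℚ),((3 : ℤ) : ℚ)]) = σf ((b : ℍ[ℚ,((-1 : ℤ) : ℚ),((3 : ℤ) : ℚ)]) * γ * ((b⁻¹ : (ℍ[ℚ,((-1 : ℤ) : ℚ),((3 : ℤ) : ℚ)])ˣ) : ℍ[ℚ,((-1 : ℤ) : ℚ),((3 : ℤ) : ℚ)])) t n f := by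
  unfold σf
  exact conj_algebraMap_add_smul₆₃ b _ _ γ

/-- `z ∈ B_f(γ) ⟺ bzb⁻¹ ∈ B_f(bγb⁻¹)`. [cite: Cox2013, §7.A Lemma 7.2] -/
theorem conj_mem_ordOf_iff (b : (ℍ[ℚ,((-1 : ℤ) : ℚ),((3 : ℤ) : ℚ)])ˣ) (γ z : ℍ[ℚ,((-1 : ℤ) : ℚ),((3 : ℤ) : ℚ)]) (t : ℤ) (n f : ℕ) :
    (b : ℍ[ℚ,((-1 : ℤ) : ℚ),((3 : ℤ) : ℚ)]) * z * ((b⁻¹ : (ℍ[ℚ,((-1 : ℤ) : ℚ),((3 : ℤ) : ℚ)])ˣ) : ℍ[ℚ,((-1 : ℤ) : ℚ),((3 : ℤ) : ℚ)]) ∈ ordOf ((b : ℍ[ℚ,((-1 : ℤ) : ℚ),((3 : ℤ) : ℚ)]) * γ * ((b⁻¹ : (ℍ[ℚ,((-1 : ℤ) : ℚ),((3 : ℤ) : ℚ)])ˣ) : ℍ[ℚ,((-1 : ℤ) : ℚ),((3 : ℤ) : ℚ)])) t n f ↔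
      z ∈ ordOf γ t n f := by
  rw [mem_ordOf_iff, mem_ordOf_iff]
  constructor
  · rintro ⟨u, v, huv⟩
    refine ⟨u, v, ?_⟩
    have e : z = ((b⁻¹ : (ℍ[ℚ,((-1 : ℤ) : ℚ),((3 : ℤ) : ℚ)])ˣ) : ℍ[ℚ,((-1 : ℤ) : ℚ),((3 : ℤ) : ℚ)]) * ((b : ℍ[ℚ,((-1 : ℤ) : ℚ),((3 : ℤ) : ℚ)]) * z * ((b⁻¹ : (ℍ[ℚ,((-1 : ℤ) : ℚ),((3 : ℤ) : ℚ)])ˣ) : ℍ[ℚ,((-1 : ℤ) : ℚ),((3 : ℤ) : ℚ)])) * b := by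
      rw [← mul_assoc, ← mul_assoc, Units.inv_mul, one_mul, mul_assoc, Units.inv_mul, mul_one]
    rw [e, huv, ← conj_σf, ← Int.cast_smul_eq_zsmul ℚ v, ← Int.cast_smul_eq_zsmul ℚ v,
      ← conj_algebraMap_add_smul₆₃ b, ← mul_assoc, ← mul_assoc, Units.inv_mul, one_mul, mul_assoc, Units.inv_mul,
      mul_one]
  · rintro ⟨u, v, rfl⟩
    refine ⟨u, v, ?_⟩
    rw [← Int.cast_smul_eq_zsmul ℚ v, ← Int.cast_smul_eq_zsmul ℚ v, conj_algebraMap_add_smul₆₃, conj_σf]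

/-- **Transport of optimal orders along `J = b⁻¹O₆`**: `O_L(b⁻¹O₆) ∩ ℚ(γ) = B_f(γ) ⟺ O₆ ∩ ℚ(bγb⁻¹) = B_f(bγb⁻¹)`
(conjugation by `b` carries `O_L(b⁻¹O₆) = b⁻¹O₆b` onto `O₆`, `ℚ(γ)` onto `ℚ(bγb⁻¹)` and `σ_f(γ)` onto `σ_f(bγb⁻¹)`).
[cite: VignerasLNM800, Ch. III §5 Thm. 5.11 (proof (2)); Ch. II §3 Définition] -/
theorem optimalOrder_inv_smul_maxOrderLattice_eq_ordOf_iff [IsQuaternionAlgebra ℚ ℍ[ℚ,((-1 : ℤ) : ℚ),((3 : ℤ) : ℚ)]] {γ : ℍ[ℚ,((-1 : ℤ) : ℚ),((3 : ℤ) : ℚ)]}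
    (hγ : γ ∉ (⊥ : Subalgebra ℚ ℍ[ℚ,((-1 : ℤ) : ℚ),((3 : ℤ) : ℚ)])) (b : (ℍ[ℚ,((-1 : ℤ) : ℚ),((3 : ℤ) : ℚ)])ˣ) (t : ℤ) (n f : ℕ) :
    optimalOrder (b⁻¹ • (Submodule.span ℤ (Set.range ![(⟨1/2, 1/2, 1/2, -1/2⟩ : ℍ[ℚ,((-1 : ℤ) : ℚ),((3 : ℤ) : ℚ)]), ⟨0, 1, 0, 0⟩, ⟨0, 0, 1, 0⟩, ⟨0, 0, 0, 1⟩]))) γ = ordOf γ t n f ↔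
      optimalOrder (Submodule.span ℤ (Set.range ![(⟨1/2, 1/2, 1/2, -1/2⟩ : ℍ[ℚ,((-1 : ℤ) : ℚ),((3 : ℤ) : ℚ)]), ⟨0, 1, 0, 0⟩, ⟨0, 0, 1, 0⟩, ⟨0, 0, 0, 1⟩])) ((b : ℍ[ℚ,((-1 : ℤ) : ℚ),((3 : ℤ) : ℚ)]) * γ * ((b⁻¹ : (ℍ[ℚ,((-1 : ℤ) : ℚ),((3 : ℤ) : ℚ)])ˣ) : ℍ[ℚ,((-1 : ℤ) : ℚ),((3 : ℤ) : ℚ)])) =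
        ordOf ((b : ℍ[ℚ,((-1 : ℤ) : ℚ),((3 : ℤ) : ℚ)]) * γ * ((b⁻¹ : (ℍ[ℚ,((-1 : ℤ) : ℚ),((3 : ℤ) : ℚ)])ˣ) : ℍ[ℚ,((-1 : ℤ) : ℚ),((3 : ℤ) : ℚ)])) t n f := by
  -- membership transports along `φ z = bzb⁻¹`
  have hA : ∀ z, z ∈ optimalOrder (b⁻¹ • (Submodule.span ℤ (Set.range ![(⟨1/2, 1/2, 1/2, -1/2⟩ : ℍ[ℚ,((-1 : ℤ) : ℚ),((3 : ℤ) : ℚ)]), ⟨0, 1, 0, 0⟩, ⟨0, 0, 1, 0⟩, ⟨0, 0, 0, 1⟩]))) γ ↔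
      (b : ℍ[ℚ,((-1 : ℤ) : ℚ),((3 : ℤ) : ℚ)]) * z * ((b⁻¹ : (ℍ[ℚ,((-1 : ℤ) : ℚ),((3 : ℤ) : ℚ)])ˣ) : ℍ[ℚ,((-1 : ℤ) : ℚ),((3 : ℤ) : ℚ)]) ∈ optimalOrder (Submodule.span ℤ (Set.range ![(⟨1/2, 1/2, 1/2, -1/2⟩ : ℍ[ℚ,((-1 : ℤ) : ℚ),((3 : ℤ) : ℚ)]), ⟨0, 1, 0, 0⟩, ⟨0, 0, 1, 0⟩, ⟨0, 0, 0, 1⟩])) ((b : ℍ[ℚ,((-1 : ℤ) : ℚ),((3 : ℤ) : ℚ)]) * γ * ((b⁻¹ : (ℍ[ℚ,((-1 : ℤ) : ℚ),((3 : ℤ) : ℚ)])ˣ) : ℍ[ℚ,((-1 : ℤ) : ℚ),((3 : ℤ) : ℚ)])) := by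
    intro z
    rw [mem_optimalOrder_iff, mem_optimalOrder_iff, mem_leftOrder_smul_iff, inv_inv, conj_mem_adjoin_iff hγ]
  have hB : ∀ z, z ∈ ordOf γ t n f ↔
      (b : ℍ[ℚ,((-1 : ℤ) : ℚ),((3 : ℤ) : ℚ)]) * z * ((b⁻¹ : (ℍ[ℚ,((-1 : ℤ) : ℚ),((3 : ℤ) : ℚ)])ˣ) : ℍ[ℚ,((-1 : ℤ) : ℚ),((3 : ℤ) : ℚ)]) ∈ ordOf ((b : ℍ[ℚ,((-1 : ℤ) : ℚ),((3 : ℤ) : ℚ)]) * γ * ((b⁻¹ : (ℍ[ℚ,((-1 : ℤ) : ℚ),((3 : ℤ) : ℚ)])ˣ) : ℍ[ℚ,((-1 : ℤ) : ℚ),((3 : ℤ) : ℚ)])) t n f :=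
    fun z => (conj_mem_ordOf_iff b γ z t n f).symm
  have hsurj : ∀ w : ℍ[ℚ,((-1 : ℤ) : ℚ),((3 : ℤ) : ℚ)], ∃ z, (b : ℍ[ℚ,((-1 : ℤ) : ℚ),((3 : ℤ) : ℚ)]) * z * ((b⁻¹ : (ℍ[ℚ,((-1 : ℤ) : ℚ),((3 : ℤ) : ℚ)])ˣ) : ℍ[ℚ,((-1 : ℤ) : ℚ),((3 : ℤ) : ℚ)]) = w := fun w =>
    ⟨((b⁻¹ : (ℍ[ℚ,((-1 : ℤ) : ℚ),((3 : ℤ) : ℚ)])ˣ) : ℍ[ℚ,((-1 : ℤ) : ℚ),((3 : ℤ) : ℚ)]) * w * b, by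
      rw [← mul_assoc, ← mul_assoc, Units.mul_inv, one_mul, mul_assoc, Units.mul_inv, mul_one]⟩
  constructor
  · intro h
    ext w
    obtain ⟨z, rfl⟩ := hsurj w
    rw [← hA, ← hB, h]
  · intro h
    ext z
    rw [hA, hB, h]

/-- **The optimal order of the class `ψ(ŷ)`**: `O_L(rep ψ(ŷ)) ∩ ℚ(γ) = B_f(γ) ⟺ O₆ ∩ ℚ(ŷ) = B_f(ŷ)`
(`ψ(ŷ) = [b⁻¹O₆]` with `bγb⁻¹ = ŷ`; the representative differs by `ℚ(γ)ˣ`, which does not change optimal orders).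
[cite: VignerasLNM800, Ch. III §5 Thm. 5.11 (proof (2))] -/
theorem optimalOrder_psi_pureVec_eq_ordOf_iff [IsQuaternionAlgebra ℚ ℍ[ℚ,((-1 : ℤ) : ℚ),((3 : ℤ) : ℚ)]] {γ : ℍ[ℚ,((-1 : ℤ) : ℚ),((3 : ℤ) : ℚ)]}
    (hγ : γ ∉ (⊥ : Subalgebra ℚ ℍ[ℚ,((-1 : ℤ) : ℚ),((3 : ℤ) : ℚ)])) (hγ0 : γ.re = 0) {m : ℕ} (hγm : (γ * star γ).re = ((m : ℕ) : ℤ))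
    (y : {x : ℤ × ℤ × ℤ // x.1 ^ 2 - 3 * x.2.1 ^ 2 - 3 * x.2.2 ^ 2 = (m : ℤ)}) (f : ℕ) :
    optimalOrder ((coreHyp_maxOrderLattice hγ).psi ⟨_, pureVec_mem_traceNormSet hγ0 hγm y⟩).rep γ = ordOf γ 0 m f ↔
      optimalOrder (Submodule.span ℤ (Set.range ![(⟨1/2, 1/2, 1/2, -1/2⟩ : ℍ[ℚ,((-1 : ℤ) : ℚ),((3 : ℤ) : ℚ)]), ⟨0, 1, 0, 0⟩, ⟨0, 0, 1, 0⟩, ⟨0, 0, 0, 1⟩])) (⟨0, y.1.1, y.1.2.1, y.1.2.2⟩ : ℍ[ℚ,((-1 : ℤ) : ℚ),((3 : ℤ) : ℚ)]) = ordOf (⟨0, y.1.1, y.1.2.1, y.1.2.2⟩ : ℍ[ℚ,((-1 : ℤ) : ℚ),((3 : ℤ) : ℚ)]) 0 m f := by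
  set Hc := coreHyp_maxOrderLattice hγ with hHc
  set x : (traceNormSet (Submodule.span ℤ (Set.range ![(⟨1/2, 1/2, 1/2, -1/2⟩ : ℍ[ℚ,((-1 : ℤ) : ℚ),((3 : ℤ) : ℚ)]), ⟨0, 1, 0, 0⟩, ⟨0, 0, 1, 0⟩, ⟨0, 0, 0, 1⟩])) (reducedTrace ℚ ℍ[ℚ,((-1 : ℤ) : ℚ),((3 : ℤ) : ℚ)] γ) (reducedNorm ℚ ℍ[ℚ,((-1 : ℤ) : ℚ),((3 : ℤ) : ℚ)] γ)) := ⟨_, pureVec_mem_traceNormSet hγ0 hγm y⟩ with hxdef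
  have hspec : (Hc.conjugator x : ℍ[ℚ,((-1 : ℤ) : ℚ),((3 : ℤ) : ℚ)]) * γ * (((Hc.conjugator x)⁻¹ : (ℍ[ℚ,((-1 : ℤ) : ℚ),((3 : ℤ) : ℚ)])ˣ) : ℍ[ℚ,((-1 : ℤ) : ℚ),((3 : ℤ) : ℚ)]) = ⟨0, y.1.1, y.1.2.1, y.1.2.2⟩ :=
    Hc.conjugator_spec x
  show optimalOrder (ThroughClass.mk (Hc.throughOf x)).rep γ = ordOf γ 0 m f ↔ _
  rw [ThroughClass.optimalOrder_rep_mk forall_isUnit_neg_one_three hγ, CoreHyp.coe_throughOf,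
    optimalOrder_inv_smul_maxOrderLattice_eq_ordOf_iff hγ, hspec]

end Transport

/-! ## §4 `#{[J] : O_L(J) ∩ ℚ(γ) = B_{f₁}} = |L_prim(m)/O₆^×|` -/

section Count

/-- **`#{[J] ∈ ThroughClass O₆ γ : O_L(J) ∩ ℚ(γ) = B_{f₁}(γ)} = P(m) = |L_prim(m)/O₆^×|`** for a pure `γ ∈ B` of norm
`m > 0` (`f₁ = 2` if `m ≡ 3 (mod 4)`, else `1`): under `[y] ↦ ψ(ŷ)` the classes of ideals through `γ` with the bottom
optimal order correspond exactly to the `O₆^×`-classes of PRIMITIVE special vectors — the number Eichler's formula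
evaluates. [cite: VignerasLNM800, Ch. III §5 Thm. 5.11 (proof (2)), Cor. 5.12–5.14] [cite: KudlaRapoportYang2006, §3.4 (3.4.6) and (3.4.13)] -/
theorem card_throughClass_ordOf_eq_card_primitive_classes {γ : ℍ[ℚ,((-1 : ℤ) : ℚ),((3 : ℤ) : ℚ)]} (hγ : γ ∉ (⊥ : Subalgebra ℚ ℍ[ℚ,((-1 : ℤ) : ℚ),((3 : ℤ) : ℚ)]))
    (hγ0 : γ.re = 0) {m : ℕ} (hm : 0 < m) (hγm : (γ * star γ).re = ((m : ℕ) : ℤ)) :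
    Nat.card {q : ThroughClass (Submodule.span ℤ (Set.range ![(⟨1/2, 1/2, 1/2, -1/2⟩ : ℍ[ℚ,((-1 : ℤ) : ℚ),((3 : ℤ) : ℚ)]), ⟨0, 1, 0, 0⟩, ⟨0, 0, 1, 0⟩, ⟨0, 0, 0, 1⟩])) γ // optimalOrder q.rep γ = ordOf γ 0 m (if (m : ℤ) % 4 = 3 then 2 else 1)} =
      Nat.card (Quot (fun x y : {x : ℤ × ℤ × ℤ // x.1 ^ 2 - 3 * x.2.1 ^ 2 - 3 * x.2.2 ^ 2 = (m : ℤ) ∧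
      ∃ u : ℤ × ℤ × ℤ, u.1 * x.1 + u.2.1 * x.2.1 + u.2.2 * x.2.2 = 1} ↦
      ∃ v : ℍ[ℚ,((-1 : ℤ) : ℚ),((3 : ℤ) : ℚ)], (v ∈ order (-1) 3 ∨ v - ⟨1/2, 1/2, 1/2, -1/2⟩ ∈ order (-1) 3) ∧
        ((v * star v).re = 1 ∨ (v * star v).re = -1) ∧
        v * ⟨0, x.1.1, x.1.2.1, x.1.2.2⟩ = ⟨0, y.1.1, y.1.2.1, y.1.2.2⟩ * v)) := by
  haveI := isQuaternionAlgebra_neg_one_three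
  set Hc := coreHyp_maxOrderLattice hγ with hHc
  have hopt : ∀ y : {x : ℤ × ℤ × ℤ // x.1 ^ 2 - 3 * x.2.1 ^ 2 - 3 * x.2.2 ^ 2 = (m : ℤ)},
      optimalOrder (Hc.psi ⟨_, pureVec_mem_traceNormSet hγ0 hγm y⟩).rep γ = ordOf γ 0 m (if (m : ℤ) % 4 = 3 then 2 else 1) ↔
        ∃ u : ℤ × ℤ × ℤ, u.1 * y.1.1 + u.2.1 * y.1.2.1 + u.2.2 * y.1.2.2 = 1 := fun y => by
    rw [optimalOrder_psi_pureVec_eq_ordOf_iff hγ hγ0 hγm y, optimalOrder_maxOrderLattice_pureVec_eq_ordOf_iff hm y]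
  let Φ : (Quot (fun x y : {x : ℤ × ℤ × ℤ // x.1 ^ 2 - 3 * x.2.1 ^ 2 - 3 * x.2.2 ^ 2 = (m : ℤ) ∧
      ∃ u : ℤ × ℤ × ℤ, u.1 * x.1 + u.2.1 * x.2.1 + u.2.2 * x.2.2 = 1} ↦
      ∃ v : ℍ[ℚ,((-1 : ℤ) : ℚ),((3 : ℤ) : ℚ)], (v ∈ order (-1) 3 ∨ v - ⟨1/2, 1/2, 1/2, -1/2⟩ ∈ order (-1) 3) ∧
        ((v * star v).re = 1 ∨ (v * star v).re = -1) ∧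
        v * ⟨0, x.1.1, x.1.2.1, x.1.2.2⟩ = ⟨0, y.1.1, y.1.2.1, y.1.2.2⟩ * v)) → {q : ThroughClass (Submodule.span ℤ (Set.range ![(⟨1/2, 1/2, 1/2, -1/2⟩ : ℍ[ℚ,((-1 : ℤ) : ℚ),((3 : ℤ) : ℚ)]), ⟨0, 1, 0, 0⟩, ⟨0, 0, 1, 0⟩, ⟨0, 0, 0, 1⟩])) γ // optimalOrder q.rep γ = ordOf γ 0 m (if (m : ℤ) % 4 = 3 then 2 else 1)} :=
    Quot.lift (fun y : {x : ℤ × ℤ × ℤ // x.1 ^ 2 - 3 * x.2.1 ^ 2 - 3 * x.2.2 ^ 2 = (m : ℤ) ∧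
      ∃ u : ℤ × ℤ × ℤ, u.1 * x.1 + u.2.1 * x.2.1 + u.2.2 * x.2.2 = 1} =>
        ⟨Hc.psi ⟨_, pureVec_mem_traceNormSet hγ0 hγm ⟨y.1, y.2.1⟩⟩, (hopt ⟨y.1, y.2.1⟩).2 y.2.2⟩)
      (fun y y' h => Subtype.ext (psi_pureVec_eq_of_conj hγ hγ0 hγm (y := ⟨y.1, y.2.1⟩) (y' := ⟨y'.1, y'.2.1⟩) h))
  refine (Nat.card_eq_of_bijective Φ ⟨?_, ?_⟩).symm
  · intro a b
    induction a using Quot.ind with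
    | _ y =>
      induction b using Quot.ind with
      | _ y' =>
        intro h
        have h' := congrArg Subtype.val h
        exact Quot.sound ((psi_pureVec_eq_iff hγ hγ0 hγm ⟨y.1, y.2.1⟩ ⟨y'.1, y'.2.1⟩).1 h')
  · rintro ⟨q, hq⟩
    obtain ⟨y, hy⟩ := exists_pureVec_psi_eq hγ hγ0 hγm q
    have hprim : ∃ u : ℤ × ℤ × ℤ, u.1 * y.1.1 + u.2.1 * y.1.2.1 + u.2.2 * y.1.2.2 = 1 := by
      rw [← hy] at hq
      exact (hopt y).1 hq
    exact ⟨Quot.mk _ ⟨y.1, y.2, hprim⟩, Subtype.ext hy⟩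

/-- The same count at a special vector `γ = ŷ₀`, `y₀ ∈ L(m)`: `#{[J] through ŷ₀ : O_L(J) ∩ ℚ(ŷ₀) = B_{f₁}} = P(m)`.
[cite: VignerasLNM800, Ch. III §5 Cor. 5.12–5.14] [cite: KudlaRapoportYang2006, §3.4 (3.4.6)] -/
theorem card_throughClass_ordOf_pureVec_eq_card_primitive_classes {m : ℕ} (hm : 0 < m) (y₀ : {x : ℤ × ℤ × ℤ // x.1 ^ 2 - 3 * x.2.1 ^ 2 - 3 * x.2.2 ^ 2 = (m : ℤ)}) :
    Nat.card {q : ThroughClass (Submodule.span ℤ (Set.range ![(⟨1/2, 1/2, 1/2, -1/2⟩ : ℍ[ℚ,((-1 : ℤ) : ℚ),((3 : ℤ) : ℚ)]), ⟨0, 1, 0, 0⟩, ⟨0, 0, 1, 0⟩, ⟨0, 0, 0, 1⟩])) (⟨0, y₀.1.1, y₀.1.2.1, y₀.1.2.2⟩ : ℍ[ℚ,((-1 : ℤ) : ℚ),((3 : ℤ) : ℚ)]) //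
        optimalOrder q.rep (⟨0, y₀.1.1, y₀.1.2.1, y₀.1.2.2⟩ : ℍ[ℚ,((-1 : ℤ) : ℚ),((3 : ℤ) : ℚ)]) = ordOf (⟨0, y₀.1.1, y₀.1.2.1, y₀.1.2.2⟩ : ℍ[ℚ,((-1 : ℤ) : ℚ),((3 : ℤ) : ℚ)]) 0 m (if (m : ℤ) % 4 = 3 then 2 else 1)} =
      Nat.card (Quot (fun x y : {x : ℤ × ℤ × ℤ // x.1 ^ 2 - 3 * x.2.1 ^ 2 - 3 * x.2.2 ^ 2 = (m : ℤ) ∧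
      ∃ u : ℤ × ℤ × ℤ, u.1 * x.1 + u.2.1 * x.2.1 + u.2.2 * x.2.2 = 1} ↦
      ∃ v : ℍ[ℚ,((-1 : ℤ) : ℚ),((3 : ℤ) : ℚ)], (v ∈ order (-1) 3 ∨ v - ⟨1/2, 1/2, 1/2, -1/2⟩ ∈ order (-1) 3) ∧
        ((v * star v).re = 1 ∨ (v * star v).re = -1) ∧
        v * ⟨0, x.1.1, x.1.2.1, x.1.2.2⟩ = ⟨0, y.1.1, y.1.2.1, y.1.2.2⟩ * v)) :=
  card_throughClass_ordOf_eq_card_primitive_classes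
    (pureVec_not_mem_bot_of_norm_ne_zero y₀.2 (by exact_mod_cast hm.ne')) rfl hm
    (by
      rw [re_mul_star_eq_coords]
      have h' : ((y₀.1.1 : ℤ) : ℚ) ^ 2 - 3 * ((y₀.1.2.1 : ℤ) : ℚ) ^ 2 - 3 * ((y₀.1.2.2 : ℤ) : ℚ) ^ 2 = ((m : ℤ) : ℚ) := by
        exact_mod_cast y₀.2
      show (0 : ℚ) ^ 2 + (y₀.1.1 : ℚ) ^ 2 - 3 * (y₀.1.2.1 : ℚ) ^ 2 - 3 * (y₀.1.2.2 : ℚ) ^ 2 = ((m : ℕ) : ℤ)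
      linear_combination h')

end Count

end Literature.Geometry.Kaehler.ComplexTorus.QuaternionType
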